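import Summits.Ventures.PercRepro.C041TriDomTwoMarkDomination

/-!
# ROW C-041 — THE MONOTONE INJECTION LEMMA (Hall) AND THE TWO-MARK MONOTONE INJECTION
(p6, gen 44; P6-TWOEXIT-LEAN.md §53 ADDENDUM 13)

**THE MONOTONE INJECTION LEMMA** (`exists_monotone_injection`): if two finite sets `D`, `U` of colourings satisfy
`#(D ∩ V) ≤ #(U ∩ V)` for EVERY up-set `V` (closed under turning blue edges red, `UpSet`), then there is an injection
`φ : D → U` that only turns blue edges red (`LeCol ω (φ ω)`).  PROOF: Hall's marriage theorem
(`Finset.all_card_le_biUnion_card_iff_exists_injective`) for the bipartite graph joining `ω ∈ D` to its red-supersets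
in `U`; for a finite family `s ⊆ D` the up-closure `↑s` is an up-set, `s ⊆ D ∩ ↑s` and `U ∩ ↑s` is exactly the
neighbourhood of `s`, so the hypothesis at `V = ↑s` is Hall's condition.  The converse is immediate (an injection
moving up sends `D ∩ V` into `U ∩ V`), so the up-set inequalities for all `V` and the monotone injection are the SAME
statement (`monotone_injection_iff`).

Applied to THEOREM (TWO-MARK DOMINATION) (`count_blue_le_count_red`): **THE TWO-MARK MONOTONE INJECTION**
(`exists_monotone_injection_blue_red`): the colourings in which `x, z` are blue-connected inject, by red-ward
flips only, into those in which they are red-connected; and in the exclusive form `D = {x ~_B z, x ≁_R z}`,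
`U = {x ~_R z, x ≁_B z}` (`exists_monotone_injection_blue_only_red_only`, the subtraction of the common part
`{x ~_R z ∧ x ~_B z}` on every up-set).  The three-mark statement of the same shape — the crossed classes inject
into `(⊤, ⊥)` — is CONJECTURE (STOCHASTIC DOMINATION), stated here as `CycDomination` (its up-set form; by the
lemma equivalent to the injection form, `cycDomination_iff_injection`), with its restriction to the principal
up-sets «`S` red» (`cycDomination_forced`) — the oriented excess conjecture at every forced set.
-/

namespace PercRepro

namespace ZoneZ

namespace MultiExit

open ZoneData Finset

variable {V₁ E₁ U₁ U₂ : Type} (Z₁ : ZoneData V₁ E₁ U₁ U₂)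

/-! ## The up-closure of a family of colourings -/

/-- `ω ≤ ω` (`LeCol` is reflexive). -/
theorem LeCol.refl (ω : E₁ → Bool) : LeCol ω ω := fun _ h => h

/-- `LeCol` is transitive. -/
theorem LeCol.trans {ω ω' ω'' : E₁ → Bool} (h1 : LeCol ω ω') (h2 : LeCol ω' ω'') : LeCol ω ω'' :=
  fun e h => h2 e (h1 e h)

/-- The up-closure of a finite family of colourings. -/
def upCl (s : Finset (E₁ → Bool)) : (E₁ → Bool) → Prop := fun ω' => ∃ ω ∈ s, LeCol ω ω'

/-- The up-closure is an up-set. -/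
theorem upSet_upCl (s : Finset (E₁ → Bool)) : UpSet (upCl s) := by
  rintro ω ω' ⟨ω₀, h₀, hle⟩ hle'
  exact ⟨ω₀, h₀, hle.trans hle'⟩

/-- A member of the family lies in its up-closure. -/
theorem mem_upCl_self {s : Finset (E₁ → Bool)} {ω : E₁ → Bool} (h : ω ∈ s) : upCl s ω := ⟨ω, h, LeCol.refl ω⟩

/-! ## The monotone injection lemma -/

open Classical in
/-- **THE MONOTONE INJECTION LEMMA** (Hall): if every up-set meets `D` at most as often as `U`, there is an injection
from `D` into `U` that only turns blue edges red. -/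
theorem exists_monotone_injection (D U : Finset (E₁ → Bool))
    (h : ∀ V : (E₁ → Bool) → Prop, UpSet V → (D.filter V).card ≤ (U.filter V).card) :
    ∃ φ : (E₁ → Bool) → (E₁ → Bool), Set.InjOn φ ↑D ∧ ∀ ω ∈ D, φ ω ∈ U ∧ LeCol ω (φ ω) := by
  -- the bipartite graph: a colouring of `D` to its red-supersets in `U`
  let t : {ω // ω ∈ D} → Finset (E₁ → Bool) := fun ω => U.filter (LeCol ω.1)
  have hall : ∀ s : Finset {ω // ω ∈ D}, s.card ≤ (s.biUnion t).card := by
    intro s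
    have hV := upSet_upCl (s.image Subtype.val)
    have h1 : s.card = (s.image Subtype.val).card := (Finset.card_image_of_injective s Subtype.val_injective).symm
    have h2 : s.image Subtype.val ⊆ D.filter (upCl (s.image Subtype.val)) := by
      intro ω hω
      rw [Finset.mem_filter]
      obtain ⟨ω₀, _, rfl⟩ := Finset.mem_image.mp hω
      exact ⟨ω₀.2, mem_upCl_self hω⟩
    have h3 : U.filter (upCl (s.image Subtype.val)) ⊆ s.biUnion t := by
      intro ω' hω'
      rw [Finset.mem_filter] at hω'
      obtain ⟨hU, ω, hω, hle⟩ := hω'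
      obtain ⟨ω₀, hω₀, rfl⟩ := Finset.mem_image.mp hω
      rw [Finset.mem_biUnion]
      exact ⟨ω₀, hω₀, Finset.mem_filter.mpr ⟨hU, hle⟩⟩
    calc s.card = (s.image Subtype.val).card := h1
      _ ≤ (D.filter (upCl (s.image Subtype.val))).card := Finset.card_le_card h2
      _ ≤ (U.filter (upCl (s.image Subtype.val))).card := h _ hV
      _ ≤ (s.biUnion t).card := Finset.card_le_card h3
  obtain ⟨f, hf, hft⟩ := (Finset.all_card_le_biUnion_card_iff_exists_injective t).mp hall
  refine ⟨fun ω => if hω : ω ∈ D then f ⟨ω, hω⟩ else ω, ?_, ?_⟩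
  · intro ω hω ω' hω' heq
    simp only [Finset.mem_coe] at hω hω'
    simp only [dif_pos hω, dif_pos hω'] at heq
    exact congrArg Subtype.val (hf heq)
  · intro ω hω
    simp only [dif_pos hω]
    have := hft ⟨ω, hω⟩
    rw [Finset.mem_filter] at this
    exact this

open Classical in
/-- The converse: a monotone injection gives the up-set inequalities. -/
theorem card_le_of_monotone_injection (D U : Finset (E₁ → Bool)) (φ : (E₁ → Bool) → (E₁ → Bool))
    (hinj : Set.InjOn φ ↑D) (hφ : ∀ ω ∈ D, φ ω ∈ U ∧ LeCol ω (φ ω)) (V : (E₁ → Bool) → Prop) (hV : UpSet V) :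
    (D.filter V).card ≤ (U.filter V).card := by
  have himg : (D.filter V).image φ ⊆ U.filter V := by
    intro ω' hω'
    obtain ⟨ω, hω, rfl⟩ := Finset.mem_image.mp hω'
    rw [Finset.mem_filter] at hω ⊢
    exact ⟨(hφ ω hω.1).1, hV ω (φ ω) hω.2 (hφ ω hω.1).2⟩
  calc (D.filter V).card = ((D.filter V).image φ).card := by
        rw [Finset.card_image_of_injOn]
        intro ω hω ω' hω' heq
        exact hinj (Finset.mem_coe.mpr (Finset.mem_filter.mp (Finset.mem_coe.mp hω)).1)
          (Finset.mem_coe.mpr (Finset.mem_filter.mp (Finset.mem_coe.mp hω')).1) heq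
    _ ≤ (U.filter V).card := Finset.card_le_card himg

open Classical in
/-- The up-set inequalities for every up-set and the monotone injection are the same statement. -/
theorem monotone_injection_iff (D U : Finset (E₁ → Bool)) :
    (∀ V : (E₁ → Bool) → Prop, UpSet V → (D.filter V).card ≤ (U.filter V).card) ↔
      ∃ φ : (E₁ → Bool) → (E₁ → Bool), Set.InjOn φ ↑D ∧ ∀ ω ∈ D, φ ω ∈ U ∧ LeCol ω (φ ω) :=
  ⟨exists_monotone_injection D U, fun ⟨φ, hinj, hφ⟩ => card_le_of_monotone_injection D U φ hinj hφ⟩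

/-! ## The two-mark monotone injection -/

section TwoMark

variable [Fintype E₁] [DecidableEq E₁] (x z : V₁)

open Classical in
/-- **THE TWO-MARK MONOTONE INJECTION**: the colourings in which `x` and `z` are blue-connected inject, by red-ward
flips only, into those in which they are red-connected. -/
theorem exists_monotone_injection_blue_red :
    ∃ φ : (E₁ → Bool) → (E₁ → Bool), Set.InjOn φ {ω | Z₁.Mg x z ω} ∧
      ∀ ω, Z₁.Mg x z ω → Z₁.Rd x z (φ ω) ∧ LeCol ω (φ ω) := by
  obtain ⟨φ, hinj, hφ⟩ := exists_monotone_injection (univ.filter fun ω : E₁ → Bool => Z₁.Mg x z ω)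
    (univ.filter fun ω : E₁ → Bool => Z₁.Rd x z ω) (fun V hV => by
      have h := count_blue_le_count_red Z₁ x z hV
      simp only [Finset.filter_filter]
      convert h using 2 <;> · ext ω; simp only [Finset.mem_filter, Finset.mem_univ, true_and]; exact and_comm)
  refine ⟨φ, ?_, fun ω hω => ?_⟩
  · intro ω hω ω' hω' heq
    exact hinj (by simpa using hω) (by simpa using hω') heq
  · have := hφ ω (by simpa using hω)
    simpa using this

open Classical in
/-- The exclusive up-set inequality: on every up-set, «blue-connected and not red-connected» is outnumbered by
«red-connected and not blue-connected». -/
theorem count_blue_only_le_count_red_only {V : (E₁ → Bool) → Prop} (hV : UpSet V) :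
    (univ.filter fun ω : E₁ → Bool => V ω ∧ (Z₁.Mg x z ω ∧ ¬ Z₁.Rd x z ω)).card ≤
      (univ.filter fun ω : E₁ → Bool => V ω ∧ (Z₁.Rd x z ω ∧ ¬ Z₁.Mg x z ω)).card := by
  have h := count_blue_le_count_red Z₁ x z hV
  have hB : (univ.filter fun ω : E₁ → Bool => V ω ∧ Z₁.Mg x z ω).card =
      (univ.filter fun ω : E₁ → Bool => V ω ∧ (Z₁.Mg x z ω ∧ ¬ Z₁.Rd x z ω)).card
        + (univ.filter fun ω : E₁ → Bool => V ω ∧ (Z₁.Mg x z ω ∧ Z₁.Rd x z ω)).card := by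
    rw [← Finset.card_union_of_disjoint]
    · congr 1
      ext ω
      simp only [Finset.mem_filter, Finset.mem_univ, true_and, Finset.mem_union]
      tauto
    · rw [Finset.disjoint_left]
      intro ω h1 h2
      simp only [Finset.mem_filter, Finset.mem_univ, true_and] at h1 h2
      exact h1.2.2 h2.2.2
  have hR : (univ.filter fun ω : E₁ → Bool => V ω ∧ Z₁.Rd x z ω).card =
      (univ.filter fun ω : E₁ → Bool => V ω ∧ (Z₁.Rd x z ω ∧ ¬ Z₁.Mg x z ω)).card
        + (univ.filter fun ω : E₁ → Bool => V ω ∧ (Z₁.Mg x z ω ∧ Z₁.Rd x z ω)).card := by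
    rw [← Finset.card_union_of_disjoint]
    · congr 1
      ext ω
      simp only [Finset.mem_filter, Finset.mem_univ, true_and, Finset.mem_union]
      tauto
    · rw [Finset.disjoint_left]
      intro ω h1 h2
      simp only [Finset.mem_filter, Finset.mem_univ, true_and] at h1 h2
      exact h1.2.2 h2.2.1
  omega

open Classical in
/-- **THE TWO-MARK MONOTONE INJECTION, EXCLUSIVE FORM**: `{x ~_B z, x ≁_R z}` injects, by red-ward flips only,
into `{x ~_R z, x ≁_B z}`. -/
theorem exists_monotone_injection_blue_only_red_only :
    ∃ φ : (E₁ → Bool) → (E₁ → Bool), Set.InjOn φ {ω | Z₁.Mg x z ω ∧ ¬ Z₁.Rd x z ω} ∧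
      ∀ ω, Z₁.Mg x z ω → ¬ Z₁.Rd x z ω → (Z₁.Rd x z (φ ω) ∧ ¬ Z₁.Mg x z (φ ω)) ∧ LeCol ω (φ ω) := by
  obtain ⟨φ, hinj, hφ⟩ := exists_monotone_injection
    (univ.filter fun ω : E₁ → Bool => Z₁.Mg x z ω ∧ ¬ Z₁.Rd x z ω)
    (univ.filter fun ω : E₁ → Bool => Z₁.Rd x z ω ∧ ¬ Z₁.Mg x z ω) (fun V hV => by
      have h := count_blue_only_le_count_red_only Z₁ x z hV
      simp only [Finset.filter_filter]
      convert h using 2 <;> · ext ω; simp only [Finset.mem_filter, Finset.mem_univ, true_and]; exact and_comm)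
  refine ⟨φ, ?_, fun ω hB hR => ?_⟩
  · intro ω hω ω' hω' heq
    exact hinj (by simpa using hω) (by simpa using hω') heq
  · have := hφ ω (by simpa using And.intro hB hR)
    simpa using this

end TwoMark

/-! ## CONJECTURE (STOCHASTIC DOMINATION), its two forms and its forced-set restriction -/

section Conjecture

variable [Fintype E₁] [DecidableEq E₁] (x y z : V₁)

/-- The cyclic crossed classes `(s₁,s₂) ∪ (s₂,s₃) ∪ (s₃,s₁)` of the host with marks `x, y, z` (the anchor `x`
and the exits `y, z` of `rsig` / `bsig`): red pattern `s_i`, blue pattern `s_{i+1}`. -/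
def CycCrossed (ω : E₁ → Bool) : Prop :=
  (rsig Z₁ y z x (fun _ => EStat.free) ω = (true, false, false) ∧
      bsig Z₁ y z x (fun _ => EStat.free) ω = (false, true, false)) ∨
    (rsig Z₁ y z x (fun _ => EStat.free) ω = (false, true, false) ∧
      bsig Z₁ y z x (fun _ => EStat.free) ω = (false, false, true)) ∨
    (rsig Z₁ y z x (fun _ => EStat.free) ω = (false, false, true) ∧
      bsig Z₁ y z x (fun _ => EStat.free) ω = (true, false, false))

/-- The class `(⊤, ⊥)`: the three marks red-connected, none blue-connected. -/
def TopBot (ω : E₁ → Bool) : Prop :=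
  rsig Z₁ y z x (fun _ => EStat.free) ω = (true, true, true) ∧
    bsig Z₁ y z x (fun _ => EStat.free) ω = (false, false, false)

open Classical in
/-- **CONJECTURE (STOCHASTIC DOMINATION)**, up-set form: on every up-set of colourings the cyclic crossed classes
are outnumbered by `(⊤, ⊥)`. (A conjecture of the lane — census-true on ≈ 2.8 × 10⁷ instances, not a theorem of
this file.) -/
def CycDomination : Prop :=
  ∀ V : (E₁ → Bool) → Prop, UpSet V →
    (univ.filter fun ω : E₁ → Bool => V ω ∧ CycCrossed Z₁ x y z ω).card ≤
      (univ.filter fun ω : E₁ → Bool => V ω ∧ TopBot Z₁ x y z ω).card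

open Classical in
/-- The up-set form of the conjecture is equivalent to its injection form: a red-ward injection of the cyclic
crossed classes into `(⊤, ⊥)`. -/
theorem cycDomination_iff_injection :
    CycDomination Z₁ x y z ↔ ∃ φ : (E₁ → Bool) → (E₁ → Bool), Set.InjOn φ {ω | CycCrossed Z₁ x y z ω} ∧
      ∀ ω, CycCrossed Z₁ x y z ω → TopBot Z₁ x y z (φ ω) ∧ LeCol ω (φ ω) := by
  have key := monotone_injection_iff (univ.filter fun ω : E₁ → Bool => CycCrossed Z₁ x y z ω)
    (univ.filter fun ω : E₁ → Bool => TopBot Z₁ x y z ω)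
  constructor
  · intro h
    obtain ⟨φ, hinj, hφ⟩ := key.1 (fun V hV => by
      have h' := h V hV
      simp only [Finset.filter_filter]
      convert h' using 2 <;> · ext ω; simp only [Finset.mem_filter, Finset.mem_univ, true_and]; exact and_comm)
    refine ⟨φ, ?_, fun ω hω => ?_⟩
    · intro ω hω ω' hω' heq
      exact hinj (by simpa using hω) (by simpa using hω') heq
    · have := hφ ω (by simpa using hω)
      simpa using this
  · rintro ⟨φ, hinj, hφ⟩ V hV
    have h := key.2 ⟨φ, fun ω hω ω' hω' heq => hinj (by simpa using hω) (by simpa using hω') heq,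
      fun ω hω => by have := hφ ω (by simpa using hω); simpa using this⟩ V hV
    simp only [Finset.filter_filter] at h
    convert h using 2 <;> · ext ω; simp only [Finset.mem_filter, Finset.mem_univ, true_and]; exact and_comm

open Classical in
/-- The conjecture restricted to the principal up-sets «`S` red» is CONJECTURE (ORIENTED EXCESS AT `p ≥ ½`) at
every forced set `S`. -/
theorem cycDomination_forced (h : CycDomination Z₁ x y z) (S : Finset E₁) :
    (univ.filter fun ω : E₁ → Bool => (∀ e ∈ S, ω e = true) ∧ CycCrossed Z₁ x y z ω).card ≤
      (univ.filter fun ω : E₁ → Bool => (∀ e ∈ S, ω e = true) ∧ TopBot Z₁ x y z ω).card := by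
  have := h _ (upSet_forced S)
  convert this

end Conjecture

end MultiExit

end ZoneZ

end PercRepro
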